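import Summits.HodgeConjecture.CorCM.MultiFieldWeilForeignCurves
import Summits.HodgeConjecture.CorCM.MultiFieldWeilTwoThreefoldsForeignCurve
import HarnessLib

/-!
# MULTI-FIELD WEIL ENGINE — A SIMPLE CM THREEFOLD WITH ANY NUMBER OF PAIRWISE NON-ISOGENOUS CM ELLIPTIC CURVES: the Hodge conjecture for every
# `T^c × ∏_a E_a^{n_a}`, given ONLY Markman's fourfold theorem

Cell `pub-hodgecm2` (COR-CM), seat b30 gen 33 (2026-08-24); count-neutral own lane MULTI-FIELD WEIL ENGINE (stem `MultiFieldWeil*`), sequel of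
`CorCM/MultiFieldWeilForeignCurves.lean` (foreign CM elliptic curves join for free; two curves and a threefold).  Theorems only; no definition, no named fact, no
`sorry`.  HONEST FRAMING: conditional on the displayed Markman fourfold binder only; `HC_CM` is NOT proved and not asserted.  (Products of copies of ONE CM
variety of dimension `≤ 3`: gen 31's `hodgeConjectureFor_biproduct_const_of_dim_le_three`, `CorCM/MultiFieldWeilTwoThreefoldsForeignCurve.lean`, BY NAME.)

THE STATEMENT (**`hodgeConjectureFor_prod_simpleThreefold_cmCurves_of_markman`**).  `T ⊨ (K; Φ)` a SIMPLE abelian threefold with CM by a sextic CM field `K`;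
`E_a ⊨ (k_a; Ψ_a)` (`a ∈ I`, finite) CM elliptic curves NO TWO OF WHICH ARE ISOGENOUS (equivalently: `k_a` pairwise non-isomorphic) — nothing else.  Then the Hodge
conjecture holds for EVERY product of copies of `T` and the `E_a` — every `⨁_j (π j).elim T E` for `π : Fin N → Option I`, i.e. every `T^c × ∏_a E_a^{n_a}` — GIVEN
ONLY `Markman2025_weilClasses_algebraic_abelianFourfold`.  PROOF.  A sextic field has at most one quadratic subfield (seat b16's
`WeilFibre.nonempty_algEquiv_of_finrank_eq_two`), so at most ONE `k_{a₀}` embeds in `K`; every other curve is FOREIGN to `K` and to `k_{a₀}` and the block of those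
curves splits off (`hodgeConjectureFor_prod_of_foreignCurves`; inside it: Moonen–Zarhin Cor. (3.9), seat b16's `hodgeConjectureFor_prod_of_pairwise_not_isIsogenous`,
unconditional); the rest block `{T, E_{a₀}}` is gen 31's G6 (ANY CM curve × ANY simple CM threefold, Markman only when `k_{a₀} ↪ K`), or `{T}` alone (powers of a CM
threefold, unconditional).  The case of two curves with isomorphic fields is `hodgeConjectureFor_biproduct_comp_vec_of_two_cmCurves_simpleThreefold_of_markman`.

[cite: MoonenZarhin1999LowDim, Thm. (0.1), (0.2), §3 (3.1), Cor. (3.9), §5 (5.2)] [cite: Markman2025SurveySecant, Thm. 1.2] [cite: Gordon1999HodgeAVSurvey, §3 Theorem, 7.5–7.7, 10.10]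
[cite: Shimura1998, §6.1 Corollary of Theorem 2 (p. 41)] [cite: MumfordAV1970, §19 Thm. 1 and p. 169]

## References
* [MoonenZarhin1999LowDim] B. Moonen, Yu. Zarhin, Math. Ann. 315 (1999) 711–733.  [Markman2025SurveySecant] E. Markman, arXiv:2509.23403, Thm. 1.2.
  [Gordon1999HodgeAVSurvey] B. B. Gordon, *A survey of the Hodge conjecture for abelian varieties*.  [Shimura1998] G. Shimura, *Abelian varieties with complex
  multiplication and modular functions*, §6.1.  [MumfordAV1970] D. Mumford, *Abelian Varieties*, §19.
-/

noncomputable section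

open CategoryTheory CategoryTheory.Limits NumberField IntermediateField

namespace Summit.HodgeConjecture.CorCM.MultiFieldWeil

open Literature.AlgebraicGeometry Literature.AlgebraicGeometry.Motives Literature.AlgebraicGeometry.HodgeTheory
open Literature.AlgebraicGeometry.ComplexMultiplication (IsCMTypeRealisation)
open Literature.AlgebraicTopology.SingularHomology
open Literature.NumberTheory.ComplexMultiplication
open Literature.AlgebraicGeometry.Milne1999 (IsOfCMType)

open scoped Classical

/-! ## A simple CM threefold and a finite family of pairwise non-isogenous CM elliptic curves -/

section ThreefoldCurves

variable {I : Type} [Fintype I] {kq : I → Type} [fk : ∀ a, Field (kq a)] [nk : ∀ a, NumberField (kq a)] [ck : ∀ a, IsCMField (kq a)]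
  {E : I → AbelianVariety ℂ} {Ψ : ∀ a, CMType (kq a)} {ιE : ∀ a, 𝓞 (kq a) →+* End (E a)} {θE : ∀ a, kq a →+* Module.End ℂ (complexBetti (E a).X 1)}
  {K : Type} [fK : Field K] [nK : NumberField K] [cK : IsCMField K] {T : AbelianVariety ℂ} {Φ : CMType K} {ιT : 𝓞 K →+* End T}
  {θT : K →+* Module.End ℂ (complexBetti T.X 1)}

omit [Fintype I] nk ck nK cK in
/-- The slots `none ↦ T`, `some a ↦ E_a` over `{T, E_{a₀}}` read on `![E_{a₀}, T]` (bookkeeping). [folklore] -/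
theorem option_elim_eq_vec_two {a₀ : I} (o : Option I) (ho : o = none ∨ o = some a₀) :
    (o.elim T E : AbelianVariety ℂ) = (![E a₀, T] : Fin 2 → AbelianVariety ℂ) (if o = none then 1 else 0) := by
  rcases ho with rfl | rfl
  · rfl
  · rfl

omit [Fintype I] in
/-- **Products of copies of `T` and ONE curve `E_{a₀}`**: gen 31's G6 (ANY CM elliptic curve × ANY simple CM threefold), GIVEN ONLY Markman's fourfold theorem.
[cite: Markman2025SurveySecant, Thm. 1.2] [cite: MoonenZarhin1999LowDim, Thm. (0.1) (1), (4) with case (a)] -/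
theorem hodgeConjectureFor_prod_option_of_pair_of_markman (hW4 : Markman2025_weilClasses_algebraic_abelianFourfold) (h6 : Module.finrank ℚ K = 6)
    (hT : IsCMTypeRealisation Φ T ιT θT) (hS : T.IsSimple) (h2 : ∀ a, Module.finrank ℚ (kq a) = 2) (hE : ∀ a, IsCMTypeRealisation (Ψ a) (E a) (ιE a) (θE a))
    (a₀ : I) {M : ℕ} (ρ : Fin M → Option I) (hρ : ∀ l, ρ l = none ∨ ρ l = some a₀) :
    HodgeConjectureFor (⨁ fun l => ((ρ l).elim T E : AbelianVariety ℂ)).dim (⨁ fun l => ((ρ l).elim T E : AbelianVariety ℂ)).X := by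
  have hfun : (fun l => ((ρ l).elim T E : AbelianVariety ℂ)) = fun l => (![E a₀, T] : Fin 2 → AbelianVariety ℂ) (if ρ l = none then 1 else 0) :=
    funext fun l => option_elim_eq_vec_two (ρ l) (hρ l)
  rw [hfun]
  exact hodgeConjectureFor_biproduct_comp_vec_of_cmCurve_simpleThreefold_of_markman hW4 (h2 a₀) h6 (hE a₀) hT hS fun l => if ρ l = none then 1 else 0

/-- **Products of copies of the curves alone** (pairwise non-isogenous CM elliptic curves: Moonen–Zarhin Cor. (3.9), seat b16, UNCONDITIONAL), read on the slots
`some a ↦ E_a`. [cite: MoonenZarhin1999LowDim, Cor. (3.9)] [cite: Gordon1999HodgeAVSurvey, §3 Theorem and 10.10] -/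
theorem hodgeConjectureFor_prod_option_of_curves [Nonempty I] (h2 : ∀ a, Module.finrank ℚ (kq a) = 2)
    (hE : ∀ a, IsCMTypeRealisation (Ψ a) (E a) (ιE a) (θE a)) (hni : ∀ a b, a ≠ b → ¬ AbelianVariety.IsIsogenous (E a) (E b)) {M : ℕ}
    (ρ : Fin M → Option I) (hρ : ∀ l, ρ l ≠ none) :
    HodgeConjectureFor (⨁ fun l => ((ρ l).elim T E : AbelianVariety ℂ)).dim (⨁ fun l => ((ρ l).elim T E : AbelianVariety ℂ)).X := by
  have hex : ∀ l, ∃ a, ρ l = some a := fun l => Option.ne_none_iff_exists'.1 (hρ l)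
  choose a ha using hex
  have hfun : (fun l => ((ρ l).elim T E : AbelianVariety ℂ)) = fun l => E (a l) := funext fun l => by rw [ha l]; rfl
  rw [hfun]
  exact hodgeConjectureFor_prod_of_pairwise_not_isIsogenous h2 hE hni a

/-- **A SIMPLE CM THREEFOLD WITH ANY NUMBER OF PAIRWISE NON-ISOGENOUS CM ELLIPTIC CURVES — given ONLY Markman's fourfold theorem.**  `T ⊨ (K; Φ)` a SIMPLE abelian
threefold with CM by a sextic CM field; `E_a ⊨ (k_a; Ψ_a)` (`a ∈ I`, finite) CM elliptic curves, NO TWO ISOGENOUS — nothing assumed on the fields.  Then for every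
`π : Fin N → Option I` the Hodge conjecture holds for `⨁_j (π j).elim T E` — every `T^c × ∏_a E_a^{n_a}` — GIVEN ONLY `Markman2025_weilClasses_algebraic_abelianFourfold`.
(At most one `k_{a₀}` embeds in `K`; the other curves are FOREIGN and split off — `hodgeConjectureFor_prod_of_foreignCurves`; the rest is gen 31's G6 on `{E_{a₀}, T}`
or the powers of `T`.)  `HC_CM` is NOT asserted. [cite: MoonenZarhin1999LowDim, Thm. (0.1), (0.2), §3 (3.1), Cor. (3.9), §5 (5.2)] [cite: Markman2025SurveySecant, Thm. 1.2]
[cite: Shimura1998, §6.1 Corollary of Theorem 2 (p. 41)] -/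
theorem hodgeConjectureFor_prod_simpleThreefold_cmCurves_of_markman (hW4 : Markman2025_weilClasses_algebraic_abelianFourfold) (h6 : Module.finrank ℚ K = 6)
    (hT : IsCMTypeRealisation Φ T ιT θT) (hS : T.IsSimple) (h2 : ∀ a, Module.finrank ℚ (kq a) = 2) (hE : ∀ a, IsCMTypeRealisation (Ψ a) (E a) (ιE a) (θE a))
    (hni : ∀ a b, a ≠ b → ¬ AbelianVariety.IsIsogenous (E a) (E b)) {N : ℕ} (π : Fin N → Option I) :
    HodgeConjectureFor (⨁ fun j => ((π j).elim T E : AbelianVariety ℂ)).dim (⨁ fun j => ((π j).elim T E : AbelianVariety ℂ)).X := by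
  -- the fields of two distinct curves are not isomorphic
  have hkk : ∀ a b, a ≠ b → IsEmpty (kq a →+* kq b) := fun a b hab => ⟨fun f => by
    obtain ⟨e⟩ := exists_ringEquiv_of_ringHom_of_finrank_eq f ((h2 a).trans (h2 b).symm)
    exact hni a b hab (isIsogenous_of_ringEquiv (h2 b) (hE b) (hE a) e).symm'⟩
  -- the family over `Option I`: `none ↦ (K, T)`, `some a ↦ (k_a, E_a)` (all identifications below are definitional)
  let Kf : Option I → Type := fun o => o.elim K kq
  letI instF : ∀ o, Field (Kf o) := fun o => @Option.rec I (fun o => Field (Option.elim o K kq)) fK (fun a => fk a) o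
  letI instN : ∀ o, NumberField (Kf o) := fun o => @Option.rec I (fun o => NumberField (Option.elim o K kq)) nK (fun a => nk a) o
  haveI instC : ∀ o, IsCMField (Kf o) := fun o => @Option.rec I (fun o => IsCMField (Option.elim o K kq)) cK (fun a => ck a) o
  let Φf : ∀ o, CMType (Kf o) := fun o => @Option.rec I (fun o => CMType (Option.elim o K kq)) Φ (fun a => Ψ a) o
  let ιf : ∀ o, 𝓞 (Kf o) →+* End ((o.elim T E : AbelianVariety ℂ)) :=
    fun o => @Option.rec I (fun o => 𝓞 (Option.elim o K kq) →+* End ((o.elim T E : AbelianVariety ℂ))) ιT (fun a => ιE a) o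
  let θf : ∀ o, Kf o →+* Module.End ℂ (complexBetti (o.elim T E : AbelianVariety ℂ).X 1) :=
    fun o => @Option.rec I (fun o => Option.elim o K kq →+* Module.End ℂ (complexBetti (o.elim T E : AbelianVariety ℂ).X 1)) θT (fun a => θE a) o
  have hA : ∀ o, IsCMTypeRealisation (Φf o) ((o.elim T E : AbelianVariety ℂ)) (ιf o) (θf o) := by
    intro o
    cases o with
    | none => exact hT
    | some a => exact hE a
  by_cases hin : ∃ a₀, Nonempty (kq a₀ →+* K)
  · -- one curve `E_{a₀}` through `K`; the others are foreign to `K` and to `k_{a₀}`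
    obtain ⟨a₀, ⟨i₀⟩⟩ := hin
    haveI : Nonempty I := ⟨a₀⟩
    have hforK : ∀ a, a ≠ a₀ → IsEmpty (kq a →+* K) := fun a ha => ⟨fun f => by
      obtain ⟨e⟩ := WeilFibre.nonempty_algEquiv_of_finrank_eq_two (M := K) (h2 a) (h2 a₀) (by rw [h6]; decide) f.toRatAlgHom i₀.toRatAlgHom
      exact (hkk a a₀ ha).false e.toRingEquiv.toRingHom⟩
    by_cases hothers : ∃ a, a ≠ a₀
    · refine @hodgeConjectureFor_prod_of_foreignCurves (Option I) _ Kf instF instN instC Φf (fun o => (o.elim T E : AbelianVariety ℂ)) ιf θf hA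
        (fun o => o ≠ none ∧ o ≠ some a₀) _ ?_ ?_ ?_ ⟨none, fun h => h.1 rfl⟩ ?_ ?_ N π
      · rintro (_ | a) ⟨hne, -⟩
        · exact absurd rfl hne
        · exact h2 a
      · rintro (_ | a) (_ | b) ⟨hne, hne₀⟩ hj
        · exact absurd rfl hne
        · exact absurd rfl hne
        · exact hforK a fun h => hne₀ (by rw [h])
        · have hb : b = a₀ := by
            by_contra hb
            exact hj ⟨Option.some_ne_none b, fun h => hb (Option.some_injective _ h)⟩
          subst hb
          exact hkk a b fun h => hne₀ (by rw [h])
      · obtain ⟨a₁, ha₁⟩ := hothers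
        exact ⟨some a₁, Option.some_ne_none a₁, fun h => ha₁ (Option.some_injective _ h)⟩
      · intro M ρ hρ
        exact hodgeConjectureFor_prod_option_of_curves h2 hE hni ρ fun l => (hρ l).1
      · intro M ρ hρ
        refine hodgeConjectureFor_prod_option_of_pair_of_markman hW4 h6 hT hS h2 hE a₀ ρ fun l => ?_
        rcases h : ρ l with _ | b
        · exact Or.inl rfl
        · right
          by_contra hb
          exact hρ l ⟨by rw [h]; exact Option.some_ne_none b, by rw [h]; exact hb⟩
    · -- only one curve
      refine hodgeConjectureFor_prod_option_of_pair_of_markman hW4 h6 hT hS h2 hE a₀ π fun j => ?_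
      rcases h : π j with _ | b
      · exact Or.inl rfl
      · right
        by_contra hb
        exact hothers ⟨b, fun hba => hb (by rw [hba])⟩
  · -- no curve through `K`: all curves are foreign; the rest block is `{T}`
    have hforK : ∀ a, IsEmpty (kq a →+* K) := fun a => not_nonempty_iff.1 fun h => hin ⟨a, h⟩
    by_cases hI : Nonempty I
    · obtain ⟨a₁⟩ := hI
      haveI : Nonempty I := ⟨a₁⟩
      refine @hodgeConjectureFor_prod_of_foreignCurves (Option I) _ Kf instF instN instC Φf (fun o => (o.elim T E : AbelianVariety ℂ)) ιf θf hA
        (fun o => o ≠ none) _ ?_ ?_ ⟨some a₁, Option.some_ne_none a₁⟩ ⟨none, fun h => h rfl⟩ ?_ ?_ N π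
      · rintro (_ | a) hne
        · exact absurd rfl hne
        · exact h2 a
      · rintro (_ | a) (_ | b) hne hj
        · exact absurd rfl hne
        · exact absurd rfl hne
        · exact hforK a
        · exact absurd (Option.some_ne_none b) hj
      · intro M ρ hρ
        exact hodgeConjectureFor_prod_option_of_curves h2 hE hni ρ hρ
      · intro M ρ hρ
        have hfun : (fun l => ((ρ l).elim T E : AbelianVariety ℂ)) = fun _ => T := funext fun l => by rw [not_not.1 (hρ l)]; rfl
        rw [hfun]
        exact hodgeConjectureFor_biproduct_const_of_dim_le_three hT (by rw [AndreProductForm.dim_eq_of_isCMTypeRealisation hT, h6]) M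
    · -- no curve at all: powers of `T`
      have hπ : ∀ j, π j = none := fun j => by
        rcases h : π j with _ | a
        · rfl
        · exact absurd ⟨a⟩ hI
      have hfun : (fun j => ((π j).elim T E : AbelianVariety ℂ)) = fun _ => T := funext fun j => by rw [hπ j]; rfl
      rw [hfun]
      exact hodgeConjectureFor_biproduct_const_of_dim_le_three hT (by rw [AndreProductForm.dim_eq_of_isCMTypeRealisation hT, h6]) N

/-- **Dominated form**: everything dominated by a product of copies of a simple CM threefold and pairwise non-isogenous CM elliptic curves, given only Markman's
fourfold theorem. [cite: MoonenZarhin1999LowDim, Thm. (0.2)] [cite: Markman2025SurveySecant, Thm. 1.2] [cite: MumfordAV1970, §19 Thm. 1 and p. 169] -/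
theorem hodgeConjectureFor_of_avDominatedBy_prod_simpleThreefold_cmCurves_of_markman (hW4 : Markman2025_weilClasses_algebraic_abelianFourfold)
    (h6 : Module.finrank ℚ K = 6) (hT : IsCMTypeRealisation Φ T ιT θT) (hS : T.IsSimple) (h2 : ∀ a, Module.finrank ℚ (kq a) = 2)
    (hE : ∀ a, IsCMTypeRealisation (Ψ a) (E a) (ιE a) (θE a)) (hni : ∀ a b, a ≠ b → ¬ AbelianVariety.IsIsogenous (E a) (E b)) {N : ℕ} (π : Fin N → Option I)
    {X : AbelianVariety ℂ} (hX : Domination.AVDominatedBy X (⨁ fun j => ((π j).elim T E : AbelianVariety ℂ))) : HodgeConjectureFor X.dim X.X :=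
  Domination.hodgeConjectureFor_of_avDominatedBy (hodgeConjectureFor_prod_simpleThreefold_cmCurves_of_markman hW4 h6 hT hS h2 hE hni π) hX

end ThreefoldCurves

end Summit.HodgeConjecture.CorCM.MultiFieldWeil

end
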